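import Summits.Ventures.PercRepro.C041TriDomGlueCoinc

/-!
# ROW C-041 — THEOREM (REDUCTION TO THE HOSTS WITHOUT A CUT VERTEX), IN THE KERNEL
(p6, gen 45; P6-TWOEXIT-LEAN.md §53 ADDENDUM 16)

The induction over the cut vertices, on the number of PRESENT edges of a status.  A status `st` of the host with
marks `a, b, c` HAS A CUT (`HasCut`) if some vertex `v` has a `w`-side (`w ≠ v`, `side Z₁ st v w`) carrying a present
edge which either contains exactly one of the marks (the other two off it) or contains no mark at all.  Deleting that
side (`stOutS st v w`) lowers the number of present edges, and the statements on the host follow from those on the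
near side: the markless side is absorbed (`cycDominationS_of_marklessSide`, `sibDominationS_of_marklessSide`), a
separated mark is THEOREM (CUT-VERTEX GLUING) (`cycDominationS_of_cutVertex`, after rotating the marks so that the
separated one is the third, `cycDominationS_rot`) and the sibling's three cases
(`sibDominationS_of_cutVertex_terminal / _markx / _marky`).  **THEOREM (REDUCTION)** (`cyc_and_sib_of_noCut`): if
CONJECTURE (STOCHASTIC DOMINATION) and the sibling domination hold, for all marks, on every status WITHOUT A CUT,
they hold on every status — in particular on the all-free host (`cycDomination_of_noCut`).
-/

namespace PercRepro

namespace ZoneZ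

namespace MultiExit

open ZoneData Finset

variable {V₁ E₁ U₁ U₂ : Type} (Z₁ : ZoneData V₁ E₁ U₁ U₂) (st : E₁ → EStat)

/-! ## Rotation of the marks -/

/-- The crossed classes are invariant under the rotation `(a, b, c) ↦ (b, c, a)`. -/
theorem cycCrossedS_rot (a b c : V₁) (ω : E₁ → Bool) :
    CycCrossedS Z₁ a b c st ω ↔ CycCrossedS Z₁ b c a st ω := by
  rw [cycCrossedS_iff, cycCrossedS_iff, RdS_comm Z₁ st ω b a, RdS_comm Z₁ st ω c a, MgS_comm Z₁ st ω b a,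
    MgS_comm Z₁ st ω c a]
  tauto

/-- `(⊤, ⊥)` is invariant under the rotation. -/
theorem topBotS_rot (a b c : V₁) (ω : E₁ → Bool) : TopBotS Z₁ a b c st ω ↔ TopBotS Z₁ b c a st ω := by
  rw [topBotS_iff, topBotS_iff, RdS_comm Z₁ st ω b a, RdS_comm Z₁ st ω c a, MgS_comm Z₁ st ω b a,
    MgS_comm Z₁ st ω c a]
  tauto

section Counting

variable [Fintype E₁] [DecidableEq E₁]

open Classical in
/-- The conjecture is invariant under the rotation of the marks. -/
theorem cycDominationS_rot (a b c : V₁) : CycDominationS Z₁ a b c st ↔ CycDominationS Z₁ b c a st := by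
  constructor
  · intro h V hV
    exact (card_filter_congr' fun ω _ => and_congr_right fun _ => (cycCrossedS_rot Z₁ st a b c ω).symm).trans_le
      ((h V hV).trans_eq (card_filter_congr' fun ω _ => and_congr_right fun _ => topBotS_rot Z₁ st a b c ω))
  · intro h V hV
    exact (card_filter_congr' fun ω _ => and_congr_right fun _ => cycCrossedS_rot Z₁ st a b c ω).trans_le
      ((h V hV).trans_eq (card_filter_congr' fun ω _ => and_congr_right fun _ => (topBotS_rot Z₁ st a b c ω).symm))

end Counting

/-! ## A markless far side is absorbed -/

variable (v w : V₁)

open Classical in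
/-- The crossed classes of `stOutS`, for any marks, depend only on the outside part. -/
theorem cycCrossedS_stOutS_merge'' (a b c : V₁) (o i : E₁ → Bool) :
    CycCrossedS Z₁ a b c (stOutS Z₁ st v w) (merge (InCS Z₁ st v w) o i) ↔
      CycCrossedS Z₁ a b c (stOutS Z₁ st v w) o := by
  rw [cycCrossedS_iff, cycCrossedS_iff]
  simp only [RdS_stOutS_merge, MgS_stOutS_merge]

open Classical in
/-- The class `(⊤, ⊥)` of `stOutS`, for any marks, depends only on the outside part. -/
theorem topBotS_stOutS_merge'' (a b c : V₁) (o i : E₁ → Bool) :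
    TopBotS Z₁ a b c (stOutS Z₁ st v w) (merge (InCS Z₁ st v w) o i) ↔ TopBotS Z₁ a b c (stOutS Z₁ st v w) o := by
  rw [topBotS_iff, topBotS_iff]
  simp only [RdS_stOutS_merge, MgS_stOutS_merge]

open Classical in
/-- Off the far side, the crossed classes of a merged colouring are those of its outside part on `stOutS`. -/
theorem cycCrossedS_merge_iff_off (hw : w ≠ v) (a b c : V₁) (ha : a ∉ side Z₁ st v w) (hb : b ∉ side Z₁ st v w)
    (hc : c ∉ side Z₁ st v w) (o i : E₁ → Bool) :
    CycCrossedS Z₁ a b c st (merge (InCS Z₁ st v w) o i) ↔ CycCrossedS Z₁ a b c (stOutS Z₁ st v w) o := by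
  rw [cycCrossedS_iff, cycCrossedS_iff]
  rw [RdS_st_iff_out Z₁ st v w hw _ ha hb, RdS_st_iff_out Z₁ st v w hw _ ha hc, RdS_st_iff_out Z₁ st v w hw _ hb hc,
    MgS_st_iff_out Z₁ st v w hw _ ha hb, MgS_st_iff_out Z₁ st v w hw _ ha hc, MgS_st_iff_out Z₁ st v w hw _ hb hc]
  simp only [RdS_stOutS_merge, MgS_stOutS_merge]

open Classical in
/-- Off the far side, `(⊤, ⊥)` of a merged colouring is `(⊤, ⊥)` of its outside part on `stOutS`. -/
theorem topBotS_merge_iff_off (hw : w ≠ v) (a b c : V₁) (ha : a ∉ side Z₁ st v w) (hb : b ∉ side Z₁ st v w)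
    (hc : c ∉ side Z₁ st v w) (o i : E₁ → Bool) :
    TopBotS Z₁ a b c st (merge (InCS Z₁ st v w) o i) ↔ TopBotS Z₁ a b c (stOutS Z₁ st v w) o := by
  rw [topBotS_iff, topBotS_iff]
  rw [RdS_st_iff_out Z₁ st v w hw _ ha hb, RdS_st_iff_out Z₁ st v w hw _ ha hc, RdS_st_iff_out Z₁ st v w hw _ hb hc,
    MgS_st_iff_out Z₁ st v w hw _ ha hb, MgS_st_iff_out Z₁ st v w hw _ ha hc, MgS_st_iff_out Z₁ st v w hw _ hb hc]
  simp only [RdS_stOutS_merge, MgS_stOutS_merge]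

open Classical in
/-- Off the far side, the sibling's classes of a merged colouring are those of its outside part on `stOutS`. -/
theorem sibSrcS_merge_iff_off (hw : w ≠ v) (a b c : V₁) (ha : a ∉ side Z₁ st v w) (hb : b ∉ side Z₁ st v w)
    (hc : c ∉ side Z₁ st v w) (o i : E₁ → Bool) :
    (SibC₁ Z₁ a b c st (merge (InCS Z₁ st v w) o i) ∨ SibC₃ Z₁ a b c st (merge (InCS Z₁ st v w) o i)) ↔
      (SibC₁ Z₁ a b c (stOutS Z₁ st v w) o ∨ SibC₃ Z₁ a b c (stOutS Z₁ st v w) o) := by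
  unfold SibC₁ SibC₃
  rw [RdS_st_iff_out Z₁ st v w hw _ ha hb, RdS_st_iff_out Z₁ st v w hw _ ha hc, RdS_st_iff_out Z₁ st v w hw _ hb hc,
    MgS_st_iff_out Z₁ st v w hw _ ha hb, MgS_st_iff_out Z₁ st v w hw _ ha hc, MgS_st_iff_out Z₁ st v w hw _ hb hc]
  simp only [RdS_stOutS_merge, MgS_stOutS_merge]

open Classical in
/-- Off the far side, the sibling's target of a merged colouring is that of its outside part on `stOutS`. -/
theorem sibTopS_merge_iff_off (hw : w ≠ v) (a b c : V₁) (ha : a ∉ side Z₁ st v w) (hb : b ∉ side Z₁ st v w)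
    (hc : c ∉ side Z₁ st v w) (o i : E₁ → Bool) :
    SibTop Z₁ a b c st (merge (InCS Z₁ st v w) o i) ↔ SibTop Z₁ a b c (stOutS Z₁ st v w) o := by
  unfold SibTop
  rw [RdS_st_iff_out Z₁ st v w hw _ ha hb, RdS_st_iff_out Z₁ st v w hw _ ha hc, RdS_st_iff_out Z₁ st v w hw _ hb hc,
    MgS_st_iff_out Z₁ st v w hw _ ha hb]
  simp only [RdS_stOutS_merge, MgS_stOutS_merge]

section Markless

variable [Fintype E₁] [DecidableEq E₁]

open Classical in
/-- **A MARKLESS FAR SIDE IS ABSORBED** (the conjecture, any base status). -/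
theorem cycDominationS_of_marklessSide (hw : w ≠ v) (a b c : V₁) (ha : a ∉ side Z₁ st v w)
    (hb : b ∉ side Z₁ st v w) (hc : c ∉ side Z₁ st v w) (h1 : CycDominationS Z₁ a b c (stOutS Z₁ st v w)) :
    CycDominationS Z₁ a b c st := by
  intro V hV
  rw [card_filter_eq_sum_fibre (InCS Z₁ st v w), card_filter_eq_sum_fibre (InCS Z₁ st v w)]
  refine Finset.sum_le_sum fun i _ => ?_
  have h := fibS_le_of_stOutS Z₁ st w v _ _ (cycCrossedS_stOutS_merge'' Z₁ st v w a b c)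
    (topBotS_stOutS_merge'' Z₁ st v w a b c) h1 hV i
  exact (card_filter_congr' fun o _ => and_congr_right fun _ =>
      cycCrossedS_merge_iff_off Z₁ st v w hw a b c ha hb hc o i).trans_le (h.trans_eq
    (card_filter_congr' fun o _ => and_congr_right fun _ =>
      (topBotS_merge_iff_off Z₁ st v w hw a b c ha hb hc o i).symm))

open Classical in
/-- **A MARKLESS FAR SIDE IS ABSORBED** (the sibling, any base status). -/
theorem sibDominationS_of_marklessSide (hw : w ≠ v) (a b c : V₁) (ha : a ∉ side Z₁ st v w)
    (hb : b ∉ side Z₁ st v w) (hc : c ∉ side Z₁ st v w) (h1 : SibDominationS Z₁ a b c (stOutS Z₁ st v w)) :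
    SibDominationS Z₁ a b c st := by
  intro V hV
  rw [card_filter_eq_sum_fibre (InCS Z₁ st v w), card_filter_eq_sum_fibre (InCS Z₁ st v w)]
  refine Finset.sum_le_sum fun i _ => ?_
  have h := fibS_le_of_stOutS Z₁ st w v (fun o => SibC₁ Z₁ a b c (stOutS Z₁ st v w) o ∨ SibC₃ Z₁ a b c (stOutS Z₁ st v w) o)
    (SibTop Z₁ a b c (stOutS Z₁ st v w)) (fun o i => or_congr (sibC₁_stOutS_merge' Z₁ st w v a b c o i)
      (sibC₃_stOutS_merge' Z₁ st w v a b c o i)) (sibTop_stOutS_merge' Z₁ st w v a b c)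
    (fun V hV => (card_filter_congr' fun _ _ => Iff.rfl).trans_le ((h1 V hV).trans_eq
      (card_filter_congr' fun _ _ => Iff.rfl))) hV i
  exact (card_filter_congr' fun o _ => and_congr_right fun _ =>
      sibSrcS_merge_iff_off Z₁ st v w hw a b c ha hb hc o i).trans_le (h.trans_eq
    (card_filter_congr' fun o _ => and_congr_right fun _ =>
      (sibTopS_merge_iff_off Z₁ st v w hw a b c ha hb hc o i).symm))

end Markless

/-! ## The number of present edges drops when a side is deleted -/

section Measure

variable [Fintype E₁] [DecidableEq E₁]

open Classical in
/-- The number of present edges of a status. -/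
noncomputable def npres : ℕ := (univ.filter fun e => presE st e).card

omit [Fintype E₁] [DecidableEq E₁] in
/-- A present edge of `stOutS` is a present edge of `st` off the side. -/
theorem presE_stOutS {e : E₁} (h : presE (stOutS Z₁ st v w) e) : presE st e ∧ ¬ InCS Z₁ st v w e := by
  unfold presE stOutS at h
  by_cases hi : InCS Z₁ st v w e
  · rw [if_pos hi] at h
    exact absurd rfl h
  · rw [if_neg hi] at h
    exact ⟨h, hi⟩

omit [DecidableEq E₁] in
open Classical in
/-- Deleting a side carrying a present edge lowers the number of present edges. -/
theorem npres_stOutS_lt {e₀ : E₁} (h₀ : InCS Z₁ st v w e₀) (hp : presE st e₀) :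
    npres (stOutS Z₁ st v w) < npres st := by
  unfold npres
  apply Finset.card_lt_card
  rw [Finset.ssubset_iff_subset_ne]
  constructor
  · intro e he
    rw [Finset.mem_filter] at he ⊢
    exact ⟨Finset.mem_univ _, (presE_stOutS Z₁ st v w he.2).1⟩
  · intro heq
    have : e₀ ∈ univ.filter fun e => presE st e := by simp [hp]
    rw [← heq, Finset.mem_filter] at this
    exact (presE_stOutS Z₁ st v w this.2).2 h₀

end Measure

/-! ## Cuts -/

/-- The status has a cut: a vertex `v` with a `w`-side carrying a present edge that separates one mark from the
other two, or carries no mark. -/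
def HasCut (a b c : V₁) : Prop :=
  ∃ v w : V₁, w ≠ v ∧ (∃ e, InCS Z₁ st v w e ∧ presE st e) ∧
    ((w = c ∧ a ∉ side Z₁ st v c ∧ b ∉ side Z₁ st v c) ∨
      (w = a ∧ b ∉ side Z₁ st v a ∧ c ∉ side Z₁ st v a) ∨
      (w = b ∧ a ∉ side Z₁ st v b ∧ c ∉ side Z₁ st v b) ∨
      (a ∉ side Z₁ st v w ∧ b ∉ side Z₁ st v w ∧ c ∉ side Z₁ st v w))

section Induction

variable [Fintype E₁] [DecidableEq E₁]

/-- The induction step: every statement of a status with a cut follows from the statements of a status with fewer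
present edges. -/
theorem step_of_hasCut (a b c : V₁) (hcut : HasCut Z₁ st a b c)
    (ih : ∀ st' : E₁ → EStat, npres st' < npres st → ∀ a' b' c' : V₁,
      CycDominationS Z₁ a' b' c' st' ∧ SibDominationS Z₁ a' b' c' st') :
    CycDominationS Z₁ a b c st ∧ SibDominationS Z₁ a b c st := by
  obtain ⟨v, w, hw, ⟨e₀, he₀, hp₀⟩, hcase⟩ := hcut
  have hlt := npres_stOutS_lt Z₁ st v w he₀ hp₀
  have IH := ih (stOutS Z₁ st v w) hlt
  rcases hcase with ⟨rfl, ha, hb⟩ | ⟨rfl, hb, hc⟩ | ⟨rfl, ha, hc⟩ | ⟨ha, hb, hc⟩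
  · -- `c` separated from `a, b`
    exact ⟨cycDominationS_of_cutVertex Z₁ st a b w v hw ha hb (IH a b v).1 (IH a b v).2,
      sibDominationS_of_cutVertex_terminal Z₁ st a b w v hw ha hb (IH a b v).2⟩
  · -- `a` separated from `b, c`: rotate so that the separated mark is the third
    exact ⟨(cycDominationS_rot Z₁ st w b c).mpr
        (cycDominationS_of_cutVertex Z₁ st b c w v hw hb hc (IH b c v).1 (IH b c v).2),
      sibDominationS_of_cutVertex_markx Z₁ st w b c v hw hb hc (IH v b c).2⟩
  · -- `b` separated from `a, c`: two rotations
    exact ⟨(cycDominationS_rot Z₁ st a w c).mpr ((cycDominationS_rot Z₁ st w c a).mpr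
        (cycDominationS_of_cutVertex Z₁ st c a w v hw hc ha (IH c a v).1 (IH c a v).2)),
      sibDominationS_of_cutVertex_marky Z₁ st a w c v hw ha hc (IH a v c).2⟩
  · exact ⟨cycDominationS_of_marklessSide Z₁ st v w hw a b c ha hb hc (IH a b c).1,
      sibDominationS_of_marklessSide Z₁ st v w hw a b c ha hb hc (IH a b c).2⟩

/-- **THEOREM (REDUCTION TO THE HOSTS WITHOUT A CUT)**: if the conjecture and the sibling domination hold, for all
marks, on every status without a cut, they hold on every status. -/
theorem cyc_and_sib_of_noCut
    (hbase : ∀ st : E₁ → EStat, ∀ a b c : V₁, ¬ HasCut Z₁ st a b c →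
      CycDominationS Z₁ a b c st ∧ SibDominationS Z₁ a b c st) :
    ∀ st : E₁ → EStat, ∀ a b c : V₁, CycDominationS Z₁ a b c st ∧ SibDominationS Z₁ a b c st := by
  intro st
  suffices h : ∀ n : ℕ, ∀ st : E₁ → EStat, npres st = n → ∀ a b c : V₁,
      CycDominationS Z₁ a b c st ∧ SibDominationS Z₁ a b c st from h _ st rfl
  intro n
  induction n using Nat.strong_induction_on with
  | _ n ih =>
    intro st hst a b c
    by_cases hcut : HasCut Z₁ st a b c
    · exact step_of_hasCut Z₁ st a b c hcut fun st' hlt => ih (npres st') (hst ▸ hlt) st' rfl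
    · exact hbase st a b c hcut

/-- CONJECTURE (STOCHASTIC DOMINATION) on the all-free host, from the hosts without a cut. -/
theorem cycDomination_of_noCut
    (hbase : ∀ st : E₁ → EStat, ∀ a b c : V₁, ¬ HasCut Z₁ st a b c →
      CycDominationS Z₁ a b c st ∧ SibDominationS Z₁ a b c st) (x y z : V₁) :
    CycDomination Z₁ x y z :=
  (cyc_and_sib_of_noCut Z₁ hbase (fun _ => EStat.free) x y z).1

end Induction

end MultiExit

end ZoneZ

end PercRepro
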